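/-
Copyright (c) 2026 the pub-hodgecm-mathlib formalisation cell (harness21).  Prover seat hodgecm-mathlib-F0P3a-p01 (g34), req620 Track A «(D-RAM) FOUR-FRAME» squad, unit U2H:
the (ρ2b′-X) child (U2H ED. 15 :418) — SOCKET (C) (type RamM) organ (C-1cls)-rel «THE RELATIVE CLASS LETTER `hrel`» (LH4-p06 (g5) 2026-09-04T07:05Z (1), for (C-2TOPnear)).
2026-09-04.
-/
import Literature.NumberTheory.Automorphic.UnitaryThreeFourFrameDefs     -- ★ `IsRamifiedQuadraticDatum` (docstring reference only; the lemma is datum-free)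
import HarnessLib

/-!
# Crux `H413`, line LH4 «(D-RAM) FOUR-FRAME» road — unit U2H, (ρ2b′-X), SOCKET (C): THE RELATIVE CLASS LETTER — the `−` line's class is the `n₀`-twist of the `+` line's class

Cell `hodgecm-mathlib` (D-0151), FLOOR 0, crux item H413 = `stmt-HodgeConjecture-24833`, route of record `HCCMUnconditional`; squad F0∕P3c∕LH4; registered stub served:
`F0P3cDyRamFourFrameU2H.stub_U2H_fixedPointCensus_typeTwo_unit0` ((ρ2b′-X), U2H ED. 15 :418) through the typed bottom socket (C) `SOCKET-hOCC.v1` (869d0c15; type RamM), brick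
(C-2TOPnear) of LH4-p06 (g5) (`Theorems/F0P3cDyRamToricLevelCensusRamMTopCellsNear.lean`), which consumes ONE relative class letter
`hrel : ∃ ω_r : Kˣ, |ω_r| = 1 ∧ η_{h′} = η_h · (ρn₀∕n₀) · t(ω_r)` with `η_h := ρh∕h · t(α^{k₀})`, `η_{h′} := ρh′∕h′ · t(α^{k₀′})`, `t(y) := ρ(yΘy)∕(yΘy)` (the ★ T5c spelling),
at the two DIAGONAL levels `v_h + d_ρ + 2k₀ + 2jλ = 2m = v_{h′} + d_ρ + 2k₀′ + 2jλ`.  THEOREMS ONLY (no `def`, no instance, no notation, no `sorry`); one field `K` (= `M`);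
lane `--supports stmt-HodgeConjecture-24833 --as helper` (count-neutral).

WHAT THIS FILE PROVES (`exists_relative_translator`).  Inputs: `Θ` an involution (`ΘΘ = 1`); the `Θ` unit-norm dichotomy in ★ p857325's shape `(c₀, hdich)` and a `Θ`-fixed unit
`n₀` that is NOT a `Θ`-norm (LH4-p06's anchor); a `ρ`-datum-type uniformiser `α` (only `|α| = exp(−1)` is used); the socket's two scalars — `h` HYPERBOLIC
(`hhyper : ∃ x ≠ 0, h·Θx·x + ρ(h·Θx·x) = 0`, socket (C) verbatim) and `h′` ANISOTROPIC (`haniso : ¬ ∃ x ≠ 0, h′·Θx·x + ρ(h′·Θx·x) = 0`, ★ p858030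
`not_exists_herm_self_eq_zero_of_lineModel`), both `Θ`-fixed and non-zero with `|h| = exp(−v_h)`, `|h′| = exp(−v_{h′})` — and the level relation `v_h + 2k₀ = v_{h′} + 2k₀′`.
Argument (no parity token, no `hFN`, no class field theory): `Q := h′∕h` is `Θ`-fixed of EVEN order `exp(2(k₀′ − k₀))`, hence `Q ∈ N_Θ(Mˣ) ∪ n₀·N_Θ(Mˣ)` (the dichotomy moved along
powers of the `Θ`-norm `αΘα` of order `2`: `exists_norm_or_anchored_of_even`); `Q ∈ N_Θ(Mˣ)` would turn the hyperbolic witness of `h` into an isotropic vector for `h′`, so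
`h′ = h·n₀·N_Θ(z)`, and `ω_r := z·α^{k₀′ − k₀}` is a unit with `η_{h′} = η_h · ψ(n₀) · t(ω_r)` (`ψc := ρc∕c` and `t = ψ ∘ N_Θ` are multiplicative).
(R-26): letters = LH4-p06 (g5)'s (C-2) frame (`n₀`, dichotomy from ★ `exists_unit_norm_dichotomy_of_isRamifiedQuadraticDatum Θ …`) + socket (C) (`hhyper`, `Θh = h`) + ★ p858030;
model ℚ₂(ζ₈) ⊃ ℚ₂(i).
HONEST LABEL.  Count-neutral helper; (ρ2b′-X) stays an OPEN prover target; `HC_CM` is proved only modulo the 7 printed citations (2 remaining named inputs: hLiu418 =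
`stmt-HodgeConjecture-24832`, h413 = `stmt-HodgeConjecture-24833`) until rung 0 closes.

## References
* [Jacobowitz1962] R. Jacobowitz, *Hermitian forms over local fields*, Amer. J. Math. 84 (1962), §3 (rank-one hermitian spaces up to norms), §4.
* [Serre1979] J.-P. Serre, *Local Fields*, GTM 67 (1979), Ch. V §3 Cor. 3 (norm index two), Ch. X §1 (Hilbert 90).
* [Kottwitz1986BaseChangeUnits] R. E. Kottwitz, *Base change for unit elements of Hecke algebras*, Compositio Math. 60 (1986), §1 pp. 240–241.
-/

set_option autoImplicit false

noncomputable section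

open WithZero
open scoped Valued

namespace Summit.HodgeConjecture.HodgeConjecture.Cruxes.H413.F0P3cDyRamClassLettersRelative

variable {K : Type} [Field K] [Valued K ℤᵐ⁰] {ρ Θ : K →+* K}

/-! ## §1 The dichotomy moved along the `Θ`-norm uniformiser of `K♮` -/

/-- **THE DICHOTOMY ANCHORED AT `n₀`**: under ★ p857325's dichotomy `(c₀, hdich)`, a `Θ`-fixed unit NON-norm `n₀` represents the non-trivial class: every `Θ`-fixed unit is
`N_Θ(z)` or `n₀·N_Θ(z)`. [cite: Serre1979, Ch. V §3 Cor. 3] -/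
theorem norm_or_anchored_of_unit
    {c₀ : K} (hc₀ : Valued.v c₀ = 1) (hdich : ∀ u : K, Θ u = u → Valued.v u = 1 → (∃ z : K, z * Θ z = u) ∨ ∃ z : K, z * Θ z = c₀ * u)
    {n₀ : K} (hΘn₀ : Θ n₀ = n₀) (hn₀1 : Valued.v n₀ = 1) (hn₀N : ¬ ∃ z : K, z * Θ z = n₀)
    {u : K} (hΘu : Θ u = u) (hu1 : Valued.v u = 1) : (∃ z : K, z * Θ z = u) ∨ ∃ z : K, z * Θ z * n₀ = u := by
  rcases hdich u hΘu hu1 with h | ⟨b, hb⟩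
  · exact Or.inl h
  · rcases hdich n₀ hΘn₀ hn₀1 with h' | ⟨a, ha⟩
    · exact absurd h' hn₀N
    · right
      have hn0 : n₀ ≠ 0 := fun h0 => by rw [h0, map_zero] at hn₀1; exact zero_ne_one hn₀1
      have hc0 : c₀ ≠ 0 := fun h0 => by rw [h0, map_zero] at hc₀; exact zero_ne_one hc₀
      have hN0 : a * Θ a ≠ 0 := by rw [ha]; exact mul_ne_zero hc0 hn0
      have ha0 : a ≠ 0 := fun h0 => hN0 (by rw [h0, zero_mul])
      have hΘa0 : Θ a ≠ 0 := (map_ne_zero Θ).2 ha0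
      -- `c₀ = a·Θa ∕ n₀`, so `u = b·Θb ∕ c₀ = n₀ · N_Θ(b ∕ a)`
      refine ⟨b / a, ?_⟩
      rw [map_div₀]
      field_simp
      linear_combination n₀ * hb - u * ha

/-- **THE DICHOTOMY AT EVEN ORDER**: a `Θ`-fixed `Q` of even order `exp(2n)` is `N_Θ(z)` or `N_Θ(z)·n₀` for some `z ∈ Kˣ` — slide `Q` to a unit by the `Θ`-norm `(αΘα)^n` of the
uniformiser `α` (`|α| = exp(−1)`). [cite: Serre1979, Ch. V §3 Cor. 3] -/
theorem norm_or_anchored_of_even (hΘΘ : ∀ x, Θ (Θ x) = x) (hvΘ : ∀ x, Valued.v (Θ x) = Valued.v x)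
    {c₀ : K} (hc₀ : Valued.v c₀ = 1) (hdich : ∀ u : K, Θ u = u → Valued.v u = 1 → (∃ z : K, z * Θ z = u) ∨ ∃ z : K, z * Θ z = c₀ * u)
    {n₀ : K} (hΘn₀ : Θ n₀ = n₀) (hn₀1 : Valued.v n₀ = 1) (hn₀N : ¬ ∃ z : K, z * Θ z = n₀)
    {α : K} (hα : Valued.v α = exp (-1 : ℤ)) {Q : K} (hΘQ : Θ Q = Q) {n : ℤ} (hvQ : Valued.v Q = exp (2 * n)) :
    (∃ z : K, z * Θ z = Q) ∨ ∃ z : K, z * Θ z * n₀ = Q := by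
  have hα0 : α ≠ 0 := fun h0 => by rw [h0, map_zero] at hα; exact (exp_ne_zero hα.symm).elim
  have hΘα0 : Θ α ≠ 0 := (map_ne_zero Θ).2 hα0
  set u : K := Q * (α ^ n * Θ (α ^ n)) with hu
  have hΘu : Θ u = u := by rw [hu, map_mul, map_mul, hΘQ, hΘΘ, mul_comm (Θ (α ^ n))]
  have hvu : Valued.v u = 1 := by
    rw [hu, Valuation.map_mul, Valuation.map_mul, hvΘ, map_zpow₀, hvQ, hα, ← exp_zsmul, ← exp_add, ← exp_add, ← exp_zero]
    congr 1; simp only [smul_eq_mul]; ring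
  have hback : ∀ z : K, z * Θ z * (α ^ (-n) * Θ (α ^ (-n))) = (z * α ^ (-n)) * Θ (z * α ^ (-n)) := fun z => by
    rw [map_mul]; ring
  have hinv : (α ^ n * Θ (α ^ n)) * (α ^ (-n) * Θ (α ^ (-n))) = 1 := by
    rw [map_zpow₀, map_zpow₀, zpow_neg, zpow_neg, mul_mul_mul_comm, mul_inv_cancel₀ (zpow_ne_zero n hα0),
      mul_inv_cancel₀ (zpow_ne_zero n hΘα0), one_mul]
  rcases norm_or_anchored_of_unit hc₀ hdich hΘn₀ hn₀1 hn₀N hΘu hvu with ⟨z, hz⟩ | ⟨z, hz⟩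
  · refine Or.inl ⟨z * α ^ (-n), ?_⟩
    rw [← hback, hz, hu, mul_assoc, hinv, mul_one]
  · refine Or.inr ⟨z * α ^ (-n), ?_⟩
    rw [← hback, mul_right_comm, hz, hu, mul_assoc, hinv, mul_one]

/-! ## §2 The relative class letter -/

/-- **THE RELATIVE CLASS LETTER `hrel`** (LH4-p06 (g5) (C-2TOPnear)): for the socket's hyperbolic scalar `h` and anisotropic scalar `h′` (both `Θ`-fixed, non-zero) at the two
diagonal levels (`v_h + 2k₀ = v_{h′} + 2k₀′`), there is a unit `ω_r` with **`ρh′∕h′ · t(α^{k₀′}) = (ρh∕h · t(α^{k₀})) · (ρn₀∕n₀) · t(ω_r)`**, `t(y) = ρ(yΘy)∕(yΘy)`: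
`h′∕h` is `Θ`-fixed of even order, not a `Θ`-norm (else `h′` would be isotropic), hence `= n₀·N_Θ(z)`, and `ω_r := z·α^{k₀′ − k₀}`.
[cite: Jacobowitz1962, §3] [cite: Serre1979, Ch. V §3 Cor. 3] [cite: Kottwitz1986BaseChangeUnits, §1 pp. 240–241] -/
theorem exists_relative_translator (hΘΘ : ∀ x, Θ (Θ x) = x) (hvΘ : ∀ x, Valued.v (Θ x) = Valued.v x)
    {c₀ : K} (hc₀ : Valued.v c₀ = 1) (hdich : ∀ u : K, Θ u = u → Valued.v u = 1 → (∃ z : K, z * Θ z = u) ∨ ∃ z : K, z * Θ z = c₀ * u)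
    {n₀ : K} (hΘn₀ : Θ n₀ = n₀) (hn₀1 : Valued.v n₀ = 1) (hn₀N : ¬ ∃ z : K, z * Θ z = n₀)
    {α : K} (hα : Valued.v α = exp (-1 : ℤ))
    {h h' : K} (hΘh : Θ h = h) (hΘh' : Θ h' = h') (hh0 : h ≠ 0) (hh'0 : h' ≠ 0)
    (hhyper : ∃ x : K, x ≠ 0 ∧ h * Θ x * x + ρ (h * Θ x * x) = 0)
    (haniso : ¬ ∃ x : K, x ≠ 0 ∧ h' * Θ x * x + ρ (h' * Θ x * x) = 0)
    {vh vh' k₀ k₀' : ℤ} (hvh : Valued.v h = exp (-vh)) (hvh' : Valued.v h' = exp (-vh')) (hlev : vh + 2 * k₀ = vh' + 2 * k₀') :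
    ∃ ω : Kˣ, Valued.v (ω : K) = 1 ∧
      ρ h' / h' * (ρ (α ^ k₀' * Θ (α ^ k₀')) / (α ^ k₀' * Θ (α ^ k₀'))) =
        ρ h / h * (ρ (α ^ k₀ * Θ (α ^ k₀)) / (α ^ k₀ * Θ (α ^ k₀))) * (ρ n₀ / n₀) * (ρ ((ω : K) * Θ ω) / ((ω : K) * Θ ω)) := by
  have hα0 : α ≠ 0 := fun h0 => by rw [h0, map_zero] at hα; exact (exp_ne_zero hα.symm).elim
  have hΘα0 : Θ α ≠ 0 := (map_ne_zero Θ).2 hα0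
  have hn0 : n₀ ≠ 0 := fun h0 => by rw [h0, map_zero] at hn₀1; exact zero_ne_one hn₀1
  -- the ratio `Q = h′ ∕ h`
  set Q : K := h' / h with hQ
  have hΘQ : Θ Q = Q := by rw [hQ, map_div₀, hΘh, hΘh']
  have hvQ : Valued.v Q = exp (2 * (k₀' - k₀)) := by
    rw [hQ, map_div₀, hvh, hvh', ← exp_sub]; congr 1; omega
  have hQ0 : Q ≠ 0 := div_ne_zero hh'0 hh0
  rcases norm_or_anchored_of_even hΘΘ hvΘ hc₀ hdich hΘn₀ hn₀1 hn₀N hα hΘQ hvQ with ⟨z, hz⟩ | ⟨z, hz⟩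
  · -- `h′ = h·N_Θ(z)` would make `h′` isotropic
    exfalso
    obtain ⟨x, hx0, hx⟩ := hhyper
    have hz0 : z ≠ 0 := fun h0 => hQ0 (by rw [← hz, h0, zero_mul])
    refine haniso ⟨x / z, div_ne_zero hx0 hz0, ?_⟩
    have hΘz0 : Θ z ≠ 0 := (map_ne_zero Θ).2 hz0
    have hkey : h' * Θ (x / z) * (x / z) = h * Θ x * x := by
      have h1 : h' = h * (z * Θ z) := by rw [hz, hQ, mul_div_cancel₀ _ hh0]
      rw [h1, map_div₀]; field_simp
    rw [hkey, hx]
  · -- `h′ = h·n₀·N_Θ(z)`; the relative translator is `ω := z·α^{k₀′ − k₀}`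
    have hN0 : z * Θ z ≠ 0 := fun h0 => hQ0 (by rw [← hz, h0, zero_mul])
    have hz0 : z ≠ 0 := fun h0 => hN0 (by rw [h0, zero_mul])
    have hΘz0 : Θ z ≠ 0 := (map_ne_zero Θ).2 hz0
    have hvz : Valued.v z = exp (k₀' - k₀) := by
      have h1 : Valued.v (z * Θ z) = exp (2 * (k₀' - k₀)) := by
        rw [← hvQ, ← hz, Valuation.map_mul (x := z * Θ z), hn₀1, mul_one]
      rw [Valuation.map_mul, hvΘ] at h1
      have h2 : Valued.v z ^ 2 = exp (k₀' - k₀) ^ 2 := by rw [pow_two, h1, pow_two, ← exp_add]; congr 1; ring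
      exact (pow_left_inj₀ zero_le zero_le two_ne_zero).1 h2
    set ω : K := z * α ^ (k₀' - k₀) with hω
    have hvω : Valued.v ω = 1 := by
      rw [hω, Valuation.map_mul, hvz, map_zpow₀, hα, ← exp_zsmul, ← exp_add, ← exp_zero]; congr 1; simp only [smul_eq_mul]; ring
    have hω0 : ω ≠ 0 := fun h0 => by rw [h0, map_zero] at hvω; exact zero_ne_one hvω
    refine ⟨Units.mk0 ω hω0, hvω, ?_⟩
    rw [Units.val_mk0]
    -- the identity: `h′ = h·N_Θ(z)·n₀`, `α^{k₀′} = α^{k₀}·α^{k₀′−k₀}`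
    have h1 : h' = h * (z * Θ z * n₀) := by rw [hz, hQ, mul_div_cancel₀ _ hh0]
    have hk : α ^ k₀' = α ^ k₀ * α ^ (k₀' - k₀) := by rw [← zpow_add₀ hα0]; congr 1; ring
    have hρ0 : ∀ y : K, y ≠ 0 → ρ y ≠ 0 := fun y hy => (map_ne_zero ρ).2 hy
    rw [h1, hk, hω]
    simp only [map_mul, map_zpow₀]
    have := hρ0 h hh0; have := hρ0 z hz0; have := hρ0 (Θ z) hΘz0; have := hρ0 n₀ hn0; have := hρ0 α hα0; have := hρ0 (Θ α) hΘα0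
    have : (ρ α) ^ k₀ ≠ 0 := zpow_ne_zero _ (hρ0 α hα0)
    have : (ρ (Θ α)) ^ k₀ ≠ 0 := zpow_ne_zero _ (hρ0 _ hΘα0)
    have : α ^ k₀ ≠ 0 := zpow_ne_zero _ hα0
    have : (Θ α) ^ k₀ ≠ 0 := zpow_ne_zero _ hΘα0
    have : (ρ α) ^ (k₀' - k₀) ≠ 0 := zpow_ne_zero _ (hρ0 α hα0)
    have : (ρ (Θ α)) ^ (k₀' - k₀) ≠ 0 := zpow_ne_zero _ (hρ0 _ hΘα0)
    have : α ^ (k₀' - k₀) ≠ 0 := zpow_ne_zero _ hα0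
    have : (Θ α) ^ (k₀' - k₀) ≠ 0 := zpow_ne_zero _ hΘα0
    field_simp

end Summit.HodgeConjecture.HodgeConjecture.Cruxes.H413.F0P3cDyRamClassLettersRelative

end
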